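import Mathlib
import Summits.CriticalPhenomena.SAWScalingLimit.Theorems.SAWRestrictionRigidityAxiomsOfLimitMarkovMarkovExtension
import Summits.CriticalPhenomena.SAWScalingLimit.Theorems.SAWRestrictionRigidityAxiomsOfLimitMarkovConfigRigidity
import Summits.CriticalPhenomena.SAWScalingLimit.Theorems.SAWRestrictionRigidityAxiomsOfLimitMarkovSlitNotJordan
import Summits.CriticalPhenomena.SAWScalingLimit.Theorems.SAWRestrictionRigidityAxiomsOfLimitMarkovArcComplement
import Literature.Probability.RandomPlanarGeometry.ChordalRestrictionMarkov
import HarnessLib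

/-!
# The domain-Markov extension with an a.e.-measurable kernel (kernel-clause line)

Crux `AxiomsOfLimit` (stmt-CriticalPhenomena-1370), line `registered`, stub
`stub_isMarkovExtensionOfSoft_aem` (lead c5, wave 2). Theorems only.

This is the a.e.-measurable ("AEM") refinement of `stub_isMarkovExtensionOfSoft2`
(`…AxiomsOfLimitMarkovMarkovExtension`). From the class-level soft-Markov theorem WITH the extra
clause that, for every closed `F` and measurable `T`, the kernel read at the past `γ.stopAt F` is
a.e. a measurable function of the past, every chordal family `P` carried by simple boundary-avoiding
curves whose laws depend on the Dobrushin domain only through `(carrier, pt 0, pt 1)` admits a kernel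
`Q` with `P.IsMarkovExtension Q` AND the same AEM clause for `Q D` under `P D`, for every `D` and
every closed `F`. Configuration rigidity of typical proper pasts and the slit-not-Jordan statement,
hypotheses of `stub_isMarkovExtensionOfSoft2`, are discharged here by the landed
`stub_configRigidity`, `stub_slitNotJordan` and `stub_arcComplementConnected`.

The kernel is the one of `stub_isMarkovExtensionOfSoft2`: `Q D p := Φ (remainingDomain D p, p.target,
D.pt 1)`, where `Φ (U, x, b)` is the Dirac mass at the constant class `b` if `x = b`, else the
soft-Markov kernel of a typical proper past with configuration `(U, x, b)` if there is one, else
`P D'` for a Dobrushin domain `D'` with `(carrier, pt 0, pt 1) = (U, x, b)` if there is one, else `0`.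
For `P D`-a.e. `γ`, above a proper past `γ.stopAt F` the value of `Φ` IS the soft-Markov kernel of
`P D` (rigidity), whose AEM clause is the new hypothesis, and above a past already at `D.pt 1` it is
the constant Dirac mass; the two measurable readings are glued along the measurable set of pasts
`{p | p.target = D.pt 1}`.

References: W. Werner, *Lectures on two-dimensional critical percolation* (2007) §3.2 (2);
O. Schramm, Israel J. Math. 118 (2000) §1. All [folklore].
-/

noncomputable section

open MeasureTheory Filter Set
open scoped ENNReal

namespace Summit.CriticalPhenomena.SAWScalingLimit.Theorems.AxiomsOfLimitKernelClause

open Literature.Probability.RandomPlanarGeometry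
open Summit.CriticalPhenomena.SAWScalingLimit.Theorems.AxiomsOfLimitMarkov

/-! ### Helper lemma -/

/-- Per-domain instantiation of the soft-Markov theorem with its a.e.-measurability clause: for a
chordal family `P` carried by simple curves, each law `P D` admits a map `Q` with
`Q (const (D.pt 0)) = P D`, the Markov disintegration along `(stopAt F, startFrom F)` for every
closed `F`, and, for every closed `F` and measurable `T`, a measurable `φ` with
`Q (γ.stopAt F) T = φ (γ.stopAt F)` for `P D`-a.e. `γ`. [folklore] -/
theorem MarkovExtAEM.exists_markovKernel_of_isChordal_of_simple
    (hSoft : ∀ (μ : Measure (CurveClass ℂ)) [IsProbabilityMeasure μ] (a b : ℂ) (R : ℝ),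
      0 < R → a ≠ b →
      (∀ᵐ c ∂μ, c ∈ CurveClass.simple ∧ c.range ⊆ Metric.ball (0 : ℂ) R ∧
        c.source = a ∧ c.target = b) →
      ∃ Q : CurveClass ℂ → Measure (CurveClass ℂ), Q (CurveClass.mk (Curve.const a)) = μ ∧
        (∀ F : Set ℂ, IsClosed F → ∀ S T : Set (CurveClass ℂ), MeasurableSet S →
          MeasurableSet T →
          μ (CurveClass.stopAt F ⁻¹' S ∩ CurveClass.startFrom F ⁻¹' T) =
            ∫⁻ γ in CurveClass.stopAt F ⁻¹' S, Q (γ.stopAt F) T ∂μ) ∧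
        (∀ F : Set ℂ, IsClosed F → ∀ T : Set (CurveClass ℂ), MeasurableSet T →
          ∃ φ : CurveClass ℂ → ℝ≥0∞, Measurable φ ∧
            ∀ᵐ γ ∂μ, Q (γ.stopAt F) T = φ (γ.stopAt F)))
    (P : ChordalFamily) (hch : P.IsChordal)
    (h6 : ∀ D : DobrushinDomain, ∀ᵐ γ ∂(P D),
      γ ∈ CurveClass.simple ∧ γ.range ∩ frontier D.carrier ⊆ {D.pt 0, D.pt 1})
    (D : DobrushinDomain) :
    ∃ Q : CurveClass ℂ → Measure (CurveClass ℂ),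
      Q (CurveClass.mk (Curve.const (D.pt 0))) = P D ∧
        (∀ F : Set ℂ, IsClosed F → ∀ S T : Set (CurveClass ℂ), MeasurableSet S →
          MeasurableSet T →
          P D (CurveClass.stopAt F ⁻¹' S ∩ CurveClass.startFrom F ⁻¹' T) =
            ∫⁻ γ in CurveClass.stopAt F ⁻¹' S, Q (γ.stopAt F) T ∂(P D)) ∧
        (∀ F : Set ℂ, IsClosed F → ∀ T : Set (CurveClass ℂ), MeasurableSet T →
          ∃ φ : CurveClass ℂ → ℝ≥0∞, Measurable φ ∧
            ∀ᵐ γ ∂(P D), Q (γ.stopAt F) T = φ (γ.stopAt F)) := by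
  haveI := (hch D).1
  obtain ⟨R, hR0, hR⟩ := dobrushinDomain_closure_subset_ball D
  -- the two marked points are distinct (`MarkedDomain.pt_injective`)
  have hne : D.pt 0 ≠ D.pt 1 := fun h => absurd (D.pt_injective h) (by decide)
  refine hSoft (P D) (D.pt 0) (D.pt 1) R hR0 hne ?_
  filter_upwards [(hch D).2, h6 D] with c hc h6c
  exact ⟨h6c.1, hc.2.2.trans hR, hc.1, hc.2.1⟩

/-! ### The theorem -/

/-- **The domain-Markov extension with an a.e.-measurable kernel (registered stub
`stub_isMarkovExtensionOfSoft_aem`).** From the soft-Markov theorem on curve classes with its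
a.e.-measurability clause: every chordal family carried by simple boundary-avoiding curves whose laws
depend on the domain only through `(carrier, pt 0, pt 1)` admits `Q` with `P.IsMarkovExtension Q`
(initial, markov for every closed `F`, domain) such that, for every Dobrushin domain `D`, closed `F`
and measurable `T`, `Q D (γ.stopAt F) T` agrees `P D`-a.e. with a measurable function of
`γ.stopAt F`. Configuration rigidity and slit-not-Jordan enter through `stub_configRigidity`,
`stub_slitNotJordan`, `stub_arcComplementConnected`. [folklore] -/
theorem stub_isMarkovExtensionOfSoft_aem : (∀ (μ : MeasureTheory.Measure (Literature.Probability.RandomPlanarGeometry.CurveClass ℂ)) [MeasureTheory.IsProbabilityMeasure μ] (a b : ℂ) (R : ℝ), 0 < R → a ≠ b → Filter.Eventually (fun c : Literature.Probability.RandomPlanarGeometry.CurveClass ℂ => c ∈ Literature.Probability.RandomPlanarGeometry.CurveClass.simple ∧ c.range ⊆ Metric.ball (0:ℂ) R ∧ c.source = a ∧ c.target = b) (MeasureTheory.ae μ) → ∃ Q : Literature.Probability.RandomPlanarGeometry.CurveClass ℂ → MeasureTheory.Measure (Literature.Probability.RandomPlanarGeometry.CurveClass ℂ), Q (Literature.Probability.RandomPlanarGeometry.CurveClass.mk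 (Literature.Probability.RandomPlanarGeometry.Curve.const a)) = μ ∧ (∀ F : Set ℂ, IsClosed F → ∀ S T : Set (Literature.Probability.RandomPlanarGeometry.CurveClass ℂ), MeasurableSet S → MeasurableSet T → μ (Literature.Probability.RandomPlanarGeometry.CurveClass.stopAt F ⁻¹' S ∩ Literature.Probability.RandomPlanarGeometry.CurveClass.startFrom F ⁻¹' T) = MeasureTheory.lintegral (μ.restrict (Literature.Probability.RandomPlanarGeometry.CurveClass.stopAt F ⁻¹' S)) (fun γ => Q (γ.stopAt F) T)) ∧ (∀ F : Set ℂ, IsClosed F → ∀ T : Set (Literature.Probability.RandomPlanarGeometry.CurveClass ℂ), MeasurableSet T → ∃ φ : Literature.Probability.RandomPlanarGeometry.CurveClass ℂ → ENNReal, Measurable φ ∧ Filter.Eventually (fun γ : Literature.Probability.RandomPlanarGeometry.CurveClass ℂ => Q (γ.stopAt F) T = φ (γ.stopAt F)) (MeasureTheory.ae μ))) → ∀ P : Literature.Probability.RandomPlanarGeometry.ChordalFamily, P.IsChordal → (∀ D : Literature.Probability.RandomPlanarGeometry.DobrushinDomain, Filter.Eventually (fun γ : Literature.Probability.RandomPlanarGeometry.CurveClass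 ℂ => γ ∈ Literature.Probability.RandomPlanarGeometry.CurveClass.simple ∧ γ.range ∩ frontier D.carrier ⊆ {D.pt 0, D.pt 1}) (MeasureTheory.ae (P D))) → (∀ D D' : Literature.Probability.RandomPlanarGeometry.DobrushinDomain, D.carrier = D'.carrier → D.pt 0 = D'.pt 0 → D.pt 1 = D'.pt 1 → P D = P D') → ∃ Q : Literature.Probability.RandomPlanarGeometry.DobrushinDomain → Literature.Probability.RandomPlanarGeometry.CurveClass ℂ → MeasureTheory.Measure (Literature.Probability.RandomPlanarGeometry.CurveClass ℂ), P.IsMarkovExtension Q ∧ ∀ (D : Literature.Probability.RandomPlanarGeometry.DobrushinDomain) (F : Set ℂ), IsClosed F → ∀ T : Set (Literature.Probability.RandomPlanarGeometry.CurveClass ℂ), MeasurableSet T → ∃ φ : Literature.Probability.RandomPlanarGeometry.CurveClass ℂ → ENNReal, Measurable φ ∧ Filter.Eventually (fun γ : Literature.Probability.RandomPlanarGeometry.CurveClass ℂ => Q D (γ.stopAt F) T = φ (γ.stopAt F)) (MeasureTheory.ae (P D)) := by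
  intro hSoft P hch h6 hdep
  classical
  -- (0) configuration rigidity of typical proper pasts and slit-not-Jordan (landed bricks)
  have hRig := stub_configRigidity stub_arcComplementConnected
  have hSlit := stub_slitNotJordan stub_arcComplementConnected
  -- (1) the soft-Markov kernels with their AEM clause, as a function of (law, starting point) only
  obtain ⟨q, hq⟩ : ∃ q : Measure (CurveClass ℂ) → ℂ → CurveClass ℂ → Measure (CurveClass ℂ),
      ∀ D : DobrushinDomain, q (P D) (D.pt 0) (CurveClass.mk (Curve.const (D.pt 0))) = P D ∧
        (∀ F : Set ℂ, IsClosed F → ∀ S T : Set (CurveClass ℂ), MeasurableSet S →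
          MeasurableSet T →
          P D (CurveClass.stopAt F ⁻¹' S ∩ CurveClass.startFrom F ⁻¹' T) =
            ∫⁻ γ in CurveClass.stopAt F ⁻¹' S, q (P D) (D.pt 0) (γ.stopAt F) T ∂(P D)) ∧
        (∀ F : Set ℂ, IsClosed F → ∀ T : Set (CurveClass ℂ), MeasurableSet T →
          ∃ φ : CurveClass ℂ → ℝ≥0∞, Measurable φ ∧
            ∀ᵐ γ ∂(P D), q (P D) (D.pt 0) (γ.stopAt F) T = φ (γ.stopAt F)) := by
    have key : ∀ (μ : Measure (CurveClass ℂ)) (a : ℂ),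
        ∃ Q : CurveClass ℂ → Measure (CurveClass ℂ), ∀ D : DobrushinDomain, P D = μ → D.pt 0 = a →
          Q (CurveClass.mk (Curve.const (D.pt 0))) = P D ∧
            (∀ F : Set ℂ, IsClosed F → ∀ S T : Set (CurveClass ℂ), MeasurableSet S →
              MeasurableSet T →
              P D (CurveClass.stopAt F ⁻¹' S ∩ CurveClass.startFrom F ⁻¹' T) =
                ∫⁻ γ in CurveClass.stopAt F ⁻¹' S, Q (γ.stopAt F) T ∂(P D)) ∧
            (∀ F : Set ℂ, IsClosed F → ∀ T : Set (CurveClass ℂ), MeasurableSet T →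
              ∃ φ : CurveClass ℂ → ℝ≥0∞, Measurable φ ∧
                ∀ᵐ γ ∂(P D), Q (γ.stopAt F) T = φ (γ.stopAt F)) := by
      intro μ a
      by_cases hex : ∃ D : DobrushinDomain, P D = μ ∧ D.pt 0 = a
      · obtain ⟨D, rfl, rfl⟩ := hex
        obtain ⟨Q, hQ⟩ := MarkovExtAEM.exists_markovKernel_of_isChordal_of_simple hSoft P hch h6 D
        refine ⟨Q, fun D' hP ha => ?_⟩
        rw [hP, ha]
        exact hQ
      · exact ⟨fun _ => 0, fun D hP ha => (hex ⟨D, hP, ha⟩).elim⟩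
    choose q hq using key
    exact ⟨q, fun D => hq (P D) (D.pt 0) D rfl rfl⟩
  -- (2) the kernel as a function of the configuration (remaining domain, tip, target)
  obtain ⟨Φ, hΦ⟩ : ∃ Φ : Set ℂ → ℂ → ℂ → Measure (CurveClass ℂ), ∀ U x y, Φ U x y =
      if x = y then Measure.dirac (CurveClass.mk (Curve.const y)) else
        if h : ∃ Dp : DobrushinDomain × CurveClass ℂ,
            ((∃ γ : Curve ℂ, Function.Injective γ ∧ CurveClass.mk γ = Dp.2) ∧
              Dp.2.source = Dp.1.pt 0 ∧ Dp.2.target ∈ Dp.1.carrier ∧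
                ∀ z ∈ Dp.2.range, z ≠ Dp.1.pt 0 → z ∈ Dp.1.carrier) ∧
            remainingDomain Dp.1 Dp.2 = U ∧ Dp.2.target = x ∧ Dp.1.pt 1 = y
        then q (P h.choose.1) (h.choose.1.pt 0) h.choose.2 else
          if h' : ∃ D : DobrushinDomain, D.carrier = U ∧ D.pt 0 = x ∧ D.pt 1 = y then P h'.choose
          else 0 := ⟨_, fun _ _ _ => rfl⟩
  -- (3) INITIAL: the configuration of the trivial past is `(D.carrier, pt 0, pt 1)`
  have hinit : ∀ D : DobrushinDomain, Φ (remainingDomain D (CurveClass.mk (Curve.const (D.pt 0))))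
      (CurveClass.mk (Curve.const (D.pt 0))).target (D.pt 1) = P D := by
    intro D
    have hab : D.pt 0 ≠ D.pt 1 := fun h => absurd (D.pt_injective h) (by decide)
    rw [remainingDomain_mk_const, CurveClass.target_mk, Curve.target_def, Curve.const_apply,
      hΦ, if_neg hab]
    split_ifs with h₁ h₂
    · obtain ⟨hTS, hU, -, -⟩ := h₁.choose_spec
      exact (hSlit D _ _ hTS hU).elim
    · obtain ⟨h1, h2, h3⟩ := h₂.choose_spec
      exact hdep _ _ h1 h2 h3
    · exact (h₂ ⟨D, rfl, rfl, rfl⟩).elim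
  -- (4) typical curves: above a proper past `Φ` is the soft-Markov kernel, above a past already at
  -- `D.pt 1` the future is trivial
  have hAE : ∀ (D : DobrushinDomain) {F : Set ℂ}, IsClosed F → ∀ᵐ γ ∂P D,
      ((γ.stopAt F).target ≠ D.pt 1 →
        Φ (remainingDomain D (γ.stopAt F)) (γ.stopAt F).target (D.pt 1) =
          q (P D) (D.pt 0) (γ.stopAt F)) ∧
      ((γ.stopAt F).target = D.pt 1 → γ.startFrom F = CurveClass.mk (Curve.const (D.pt 1))) := by
    intro D F hF
    filter_upwards [(hch D).2, h6 D] with γ hc h6c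
    obtain ⟨hsrc, htgt, hcl⟩ := hc
    obtain ⟨hsim, hfr⟩ := h6c
    refine ⟨fun hne => ?_, fun he => by
      rw [SoftMarkov.startFrom_eq_of_target_stopAt hF hsim (he.trans htgt.symm), htgt]⟩
    obtain ⟨γ₀, hγ₀, rfl⟩ := hsim
    by_cases h0 : γ₀ 0 ∈ F
    · have h0' : γ₀ 0 = D.pt 0 := hsrc
      rw [(SoftMarkov.stopAt_mk_of_mem hF γ₀ h0).1, h0', hinit D, (hq D).1]
    · rw [CurveClass.stopAt_mk_holds F hF] at hne ⊢
      have hTS := MarkovExt.ts_stopAt hF D hγ₀ hsrc htgt hcl hfr h0 hne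
      rw [hΦ, if_neg hne]
      split_ifs with h₁ h₂
      · obtain ⟨hTS', hU, hx, hb⟩ := h₁.choose_spec
        obtain ⟨hcar, hpt, hp⟩ := hRig _ D _ (CurveClass.mk (γ₀.stopAt F)) hTS' hTS hU hx hb
        rw [hp, hpt, hdep _ D hcar hpt hb]
      · exact (h₁ ⟨(D, CurveClass.mk (γ₀.stopAt F)), hTS, rfl, rfl, rfl⟩).elim
      · exact (h₁ ⟨(D, CurveClass.mk (γ₀.stopAt F)), hTS, rfl, rfl, rfl⟩).elim
  refine ⟨fun D p => Φ (remainingDomain D p) p.target (D.pt 1),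
    ⟨fun D => hinit D, fun D F hF S T hS hT => ?_, fun D₁ D₂ p₁ p₂ h1 h2 h3 => ?_⟩,
    fun D F hF T hT => ?_⟩
  · -- (5) MARKOV
    have hst : Measurable (CurveClass.stopAt F : CurveClass ℂ → CurveClass ℂ) :=
      CurveClass.measurable_stopAt hF
    have hB : MeasurableSet {c : CurveClass ℂ | c.target = D.pt 1} :=
      CurveClass.continuous_target.measurable (measurableSet_singleton _)
    -- split `S` according to whether the past already ends at `D.pt 1`
    have hS₁ : MeasurableSet (CurveClass.stopAt F ⁻¹' (S \ {c | c.target = D.pt 1})) :=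
      (hS.diff hB).preimage hst
    have hS₂ : MeasurableSet (CurveClass.stopAt F ⁻¹' (S ∩ {c | c.target = D.pt 1})) :=
      (hS.inter hB).preimage hst
    have hdj : Disjoint (CurveClass.stopAt F ⁻¹' (S \ {c | c.target = D.pt 1}))
        (CurveClass.stopAt F ⁻¹' (S ∩ {c | c.target = D.pt 1})) :=
      Set.disjoint_sdiff_inter.preimage _
    have hsplit : CurveClass.stopAt F ⁻¹' S =
        CurveClass.stopAt F ⁻¹' (S \ {c | c.target = D.pt 1}) ∪
          CurveClass.stopAt F ⁻¹' (S ∩ {c | c.target = D.pt 1}) := by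
      rw [← Set.preimage_union, Set.sdiff_union_inter]
    rw [hsplit, Set.union_inter_distrib_right, measure_union (hdj.mono inter_subset_left
      inter_subset_left) (hS₂.inter (hT.preimage (CurveClass.measurable_startFrom hF))),
      lintegral_union hS₂ hdj]
    congr 1
    · -- proper pasts: the soft-Markov disintegration
      rw [(hq D).2.1 F hF _ T (hS.diff hB) hT]
      exact setLIntegral_congr_fun_ae hS₁ ((hAE D hF).mono fun γ h hγ => by rw [h.1 hγ.2])
    · -- pasts already at `D.pt 1`: the future is the constant class
      have h1 : P D (CurveClass.stopAt F ⁻¹' (S ∩ {c | c.target = D.pt 1}) ∩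
          CurveClass.startFrom F ⁻¹' T) =
          P D (CurveClass.stopAt F ⁻¹' (S ∩ {c | c.target = D.pt 1}) ∩
            {_c | CurveClass.mk (Curve.const (D.pt 1)) ∈ T}) :=
        measure_congr (eventuallyEq_set.2 ((hAE D hF).mono fun γ h => by
          simp only [Set.mem_inter_iff, Set.mem_preimage, Set.mem_setOf_eq]
          exact and_congr_right fun hγ => by rw [h.2 hγ.2]))
      have h2 : ∫⁻ γ in CurveClass.stopAt F ⁻¹' (S ∩ {c | c.target = D.pt 1}),
          Φ (remainingDomain D (γ.stopAt F)) (γ.stopAt F).target (D.pt 1) T ∂P D =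
          ∫⁻ _ in CurveClass.stopAt F ⁻¹' (S ∩ {c | c.target = D.pt 1}),
            T.indicator 1 (CurveClass.mk (Curve.const (D.pt 1))) ∂P D :=
        setLIntegral_congr_fun hS₂ fun γ hγ => by
          rw [show (γ.stopAt F).target = D.pt 1 from hγ.2, hΦ, if_pos rfl,
            Measure.dirac_apply' _ hT]
      rw [h1, h2, setLIntegral_const]
      by_cases hbT : CurveClass.mk (Curve.const (D.pt 1)) ∈ T
      · have h0 : {_c : CurveClass ℂ | CurveClass.mk (Curve.const (D.pt 1)) ∈ T} = Set.univ :=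
          Set.eq_univ_of_forall fun _ => hbT
        rw [Set.indicator_of_mem hbT, Pi.one_apply, one_mul, h0, Set.inter_univ]
      · have h0 : {_c : CurveClass ℂ | CurveClass.mk (Curve.const (D.pt 1)) ∈ T} = ∅ :=
          Set.eq_empty_of_forall_notMem fun _ h => hbT h
        rw [Set.indicator_of_notMem hbT, zero_mul, h0, Set.inter_empty, measure_empty]
  · -- (6) DOMAIN: by construction
    show Φ _ _ _ = Φ _ _ _
    rw [h1, h2, h3]
  · -- (7) AEM: glue the soft-Markov reading (proper pasts) with the Dirac reading (pasts at `pt 1`)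
    have hB : MeasurableSet {c : CurveClass ℂ | c.target = D.pt 1} :=
      CurveClass.continuous_target.measurable (measurableSet_singleton _)
    obtain ⟨φ, hφ, hγφ⟩ := (hq D).2.2 F hF T hT
    refine ⟨fun p => if p.target = D.pt 1 then
        Measure.dirac (CurveClass.mk (Curve.const (D.pt 1))) T else φ p,
      Measurable.ite hB measurable_const hφ, ?_⟩
    filter_upwards [hAE D hF, hγφ] with γ h hγ
    show Φ (remainingDomain D (γ.stopAt F)) (γ.stopAt F).target (D.pt 1) T =
      if (γ.stopAt F).target = D.pt 1 then
        Measure.dirac (CurveClass.mk (Curve.const (D.pt 1))) T else φ (γ.stopAt F)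
    by_cases he : (γ.stopAt F).target = D.pt 1
    · rw [if_pos he, he, hΦ, if_pos rfl]
    · rw [if_neg he, h.1 he, hγ]

end Summit.CriticalPhenomena.SAWScalingLimit.Theorems.AxiomsOfLimitKernelClause

end
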